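import Summits.ResolutionOfSingularities.ResolutionOfSingularities.Theorems.IndSmoothValuativeSmoothingQuadraticSequence
import Summits.ResolutionOfSingularities.ResolutionOfSingularities.Theorems.IndSmoothValuativeSmoothingSequenceCollapse
import Summits.ResolutionOfSingularities.ResolutionOfSingularities.Theorems.IndSmoothValuativeSmoothingDominatesDimLeOne
import Summits.ResolutionOfSingularities.ResolutionOfSingularities.Theorems.IndSmoothValuativeSmoothingPolynomialModel
import Summits.ResolutionOfSingularities.ResolutionOfSingularities.Theorems.IndSmoothValuativeSmoothingRegularCentre
import Literature.AlgebraicGeometry.Resolution.QuadraticTransformsProofs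
import Literature.AlgebraicGeometry.Resolution.RankOneReduction
import HarnessLib

/-!
# Relative local uniformization at valuation rings with a REGULAR CENTRE OF DIMENSION ≤ 2 on
# some affine model; hence at ALL valuation rings of `k(x, y)` (Zariski 1939 / Abhyankar 1956)

Support file for crux stmt-ResolutionOfSingularities-16087 (`ValuativeSmoothing`, route file
`Theses/IndSmooth.lean`), line `birth`, wave 4: the local-uniformization form of the fourth
proved family of the crux (`smoothFactor_of_regularCentre`,
`IndSmoothValuativeSmoothingRegularCentre.lean`). No perfectness of `k` is needed here: the
last step "regular at the centre ⇒ smooth neighbourhood" of the ind-smooth form is dropped.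

For ANY field `k`, any field `K ⊇ k`, a valuation ring `O` of `K` and a finitely generated
`k`-subalgebra `B ⊆ O` with `Frac B = K` whose local ring `locAtCentre B O = B_{𝔪_O ∩ B}` at
the centre is a REGULAR local ring of Krull dimension `≤ 2`, the valuation ring `O` admits
relative local uniformization over `k` (`RelLocalUniformization k K O`, Novacoski–Spivakovsky
Def. 2.20): every finitely generated `k`-subalgebra `R ⊆ O` (with `Frac R = K`) lies in a
finitely generated `k`-subalgebra `A ⊆ O` whose localisation at the centre `𝔪_O ∩ A` is a
regular local ring (`relLU_of_regularCentre`). Corollary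
(`relLU_of_purelyTranscendental_two`): for `K = k(x, y)` purely transcendental of
transcendence degree two, EVERY valuation ring `O ⊇ k` of `K` admits relative local
uniformization over `k`.

**Proof.** Put `R₀ = B_𝔭`, `𝔭 = 𝔪_O ∩ B`; it is dominated by `O` and has fraction field `K`.
* `dim R₀ ≤ 1`: `O = R₀` (`stub_eqOfDominatesOfDimLeOne`), so `R ⊆ locAtCentre B O`.
* `dim R₀ = 2`: `O ≠ K`; the quadratic sequence `R₀ = R 0 → R 1 → ⋯` along `O`
  (`stub_quadraticSequence`) has union `O` (ABHYANKAR'S UNION LEMMA, Abhyankar 1956, Lemma 12,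
  `AbhyankarQuadraticUnion_holds`), so the finitely many generators of `R` lie in some `R N`;
  `R N` is regular (`isRegularLocalRing_sequence`) and is the local ring at the centre of `O`
  of a finitely generated `C = B[t] ⊆ O` (`stub_sequenceCollapse`).
In both cases `R ⊆ locAtCentre C O` for a finitely generated `C ⊆ O` regular at the centre
(`exists_fg_regularCentre_model`). Writing the generators of `R` as fractions `y / z`,
`y, z ∈ C`, `ν(z) = 0`, the finitely generated `C' = C[z⁻¹, …]` satisfies
`R ≤ C' ⊆ locAtCentre C O ⊆ O` and `locAtCentre C' O = locAtCentre C O`, so `C'` is regular at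
the centre (`relLU_core_of_locAtCentre`).
* `K = k(x, y)`: `B = k[x^{±1}, y^{±1}] ⊆ O` is regular of dimension `2` (`stub_polynomialModel`).

## Sources

* S. S. Abhyankar, *On the valuations centered in a local domain*, Amer. J. Math. 78 (1956),
  Lemma 12. [Abhyankar1956Valuations]
* O. Zariski, *The reduction of the singularities of an algebraic surface*, Ann. Math. 40
  (1939) (uniformization of zero-dimensional valuations centred at a simple point).
* J. Novacoski, M. Spivakovsky, *Reduction of local uniformization to the rank one case*,
  EMS Ser. Congr. Rep. (2014), Def. 2.20. [NovacoskiSpivakovsky2014]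
-/

-- single-problem summit: the doubled namespace component is forced
set_option linter.dupNamespace false

namespace Summit.ResolutionOfSingularities.ResolutionOfSingularities.Theorems.ValuativeSmoothing

open IsLocalRing Literature.AlgebraicGeometry.Resolution

/-- **LU core: from a regular centre on an affine model to the conclusion of
`RelLocalUniformization`.** If `C ⊆ O` is a finitely generated `k`-subalgebra of the valued
field `(K, O)` which is regular at the centre of `O` (`locAtCentre C O` regular), then every
finitely generated `k`-subalgebra `R ⊆ locAtCentre C O` lies in a finitely generated
`k`-subalgebra `A ⊆ O` whose localisation at the centre `𝔪_O ∩ A` is a regular local ring.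
Writing the finitely many generators of `R` as fractions `y / z`, `y, z ∈ C`, `ν(z) = 0`, and
adjoining the `z⁻¹` to `C` gives a finitely generated `A = C' ⊆ locAtCentre C O` containing `R`
with the same local ring at the centre (monotonicity and idempotence of `locAtCentre`).
[cite: NovacoskiSpivakovsky2014, Def. 2.20] -/
theorem relLU_core_of_locAtCentre (k K : Type) [Field k] [Field K] [Algebra k K]
    (O : ValuationSubring K) (C : Subalgebra k K) (hCfg : C.FG)
    (hCO : C.toSubring ≤ O.toSubring) (hreg : IsRegularLocalRing (locAtCentre C.toSubring O))
    (R : Subalgebra k K) (hR : R.FG) (hRC : R.toSubring ≤ locAtCentre C.toSubring O) :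
    ∃ (A : Subalgebra k K) (h : A.toSubring ≤ O.toSubring), R ≤ A ∧ A.FG ∧
      IsRegularLocalRing
        (Localization.AtPrime (Ideal.comap (Subring.inclusion h) (maximalIdeal O))) := by
  classical
  -- a finite generating set `s` of `R`; each generator is a fraction `y r / z r`, `ν(z r) = 0`
  obtain ⟨s, hs⟩ := hR
  have hmem : ∀ r ∈ s, ∃ y ∈ C, ∃ z ∈ C, O.valuation z = 1 ∧ r = y / z := fun r hr =>
    hRC (show r ∈ R from hs ▸ Algebra.subset_adjoin hr)
  choose! y hy z hz hv hyz using hmem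
  -- `locAtCentre C O` as a `k`-subalgebra of `K`
  let L : Subalgebra k K :=
    { locAtCentre C.toSubring O with
      algebraMap_mem' := fun c => le_locAtCentre C.toSubring O (C.algebraMap_mem c) }
  have hCL : C ≤ L := fun x hx => le_locAtCentre C.toSubring O hx
  -- `C' := C[z r⁻¹ : r ∈ s]`
  let C' : Subalgebra k K := C ⊔ Algebra.adjoin k (↑(s.image fun r => (z r)⁻¹) : Set K)
  have hC'fg : C'.FG := hCfg.sup (Subalgebra.fg_adjoin_finset _)
  have hCC' : C ≤ C' := le_sup_left
  have hC'L : C' ≤ L := by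
    refine sup_le hCL (Algebra.adjoin_le ?_)
    intro x hx
    rw [Finset.coe_image] at hx
    obtain ⟨r, hr, rfl⟩ := hx
    exact inv_mem_locAtCentre (le_locAtCentre C.toSubring O (hz r hr)) (hv r hr)
  have hC'L' : C'.toSubring ≤ locAtCentre C.toSubring O := fun x hx => hC'L hx
  have hC'O : C'.toSubring ≤ O.toSubring := hC'L'.trans (locAtCentre_le hCO)
  -- `R ≤ C'`
  have hRC' : R ≤ C' := by
    rw [← hs]
    refine Algebra.adjoin_le ?_
    intro r hr
    have hr' : r ∈ (s : Set K) := hr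
    rw [Finset.mem_coe] at hr'
    rw [hyz r hr', div_eq_mul_inv]
    refine C'.mul_mem (hCC' (hy r hr')) ?_
    refine Algebra.mem_sup_right (Algebra.subset_adjoin ?_)
    rw [Finset.coe_image]
    exact ⟨r, hr', rfl⟩
  -- `locAtCentre C' O = locAtCentre C O`, so `C'` is regular at the centre of `O`
  have hLL : locAtCentre C'.toSubring O = locAtCentre C.toSubring O :=
    le_antisymm ((locAtCentre_mono O hC'L').trans (locAtCentre_locAtCentre C.toSubring O).le)
      (locAtCentre_mono O fun x hx => hCC' hx)
  have hregC' : IsRegularLocalRing (locAtCentre C'.toSubring O) := by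
    rw [hLL]
    exact hreg
  exact ⟨C', hC'O, hRC', hC'fg, (isRegularLocalRing_locAtCentre_iff hC'O).mp hregC'⟩

/-- **A finitely generated model regular at the centre above any `R ⊆ O`** (Zariski 1939 /
Abhyankar 1956, Lemma 12). For a field `K ⊇ k`, a valuation ring `O` of `K` and a finitely
generated `k`-subalgebra `B ⊆ O` with `Frac B = K` such that `locAtCentre B O` is a regular
local ring of Krull dimension `≤ 2`, every finitely generated `k`-subalgebra `R ⊆ O` is
contained in `locAtCentre C O` for some finitely generated `k`-subalgebra `C ⊆ O` regular at
the centre of `O`. Dimension `≤ 1`: `O = locAtCentre B O` (`stub_eqOfDominatesOfDimLeOne`),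
take `C = B`. Dimension `2`: `O ≠ K`; the quadratic sequence along `O`
(`stub_quadraticSequence`) has union `O` (`AbhyankarQuadraticUnion_holds`), so the generators
of `R` lie in a member `R N`, regular (`isRegularLocalRing_sequence`) and equal to the local
ring at the centre of a finitely generated `C = B[t] ⊆ O` (`stub_sequenceCollapse`).
[cite: Abhyankar1956Valuations, Lemma 12] -/
theorem exists_fg_regularCentre_model (k K : Type) [Field k] [Field K] [Algebra k K]
    (O : ValuationSubring K) (B : Subalgebra k K) (hBfg : B.FG)
    (hBO : B.toSubring ≤ O.toSubring) (hfrac : ∀ z : K, ∃ a ∈ B, ∃ b ∈ B, b ≠ 0 ∧ z = a / b)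
    (hreg : IsRegularLocalRing (locAtCentre B.toSubring O))
    (hdim : ringKrullDim (locAtCentre B.toSubring O) ≤ 2)
    (R : Subalgebra k K) (hR : R.FG) (hRO : R.toSubring ≤ O.toSubring) :
    ∃ C : Subalgebra k K, C.FG ∧ C.toSubring ≤ O.toSubring ∧
      IsRegularLocalRing (locAtCentre C.toSubring O) ∧
      R.toSubring ≤ locAtCentre C.toSubring O := by
  classical
  haveI := hreg
  have hdom : SubringDominates (locAtCentre B.toSubring O) O.toSubring :=
    subringDominates_locAtCentre hBO
  have hof : IsLocalRingOf (locAtCentre B.toSubring O) := by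
    refine ⟨inferInstance, fun z => ?_⟩
    obtain ⟨a, ha, b, hb, hb0, rfl⟩ := hfrac z
    exact ⟨a, le_locAtCentre _ O ha, b, le_locAtCentre _ O hb, hb0, rfl⟩
  by_cases h1 : ringKrullDim (locAtCentre B.toSubring O) ≤ 1
  · -- dimension ≤ 1: `O` is the local ring at the centre itself
    have hO : O.toSubring = locAtCentre B.toSubring O :=
      stub_eqOfDominatesOfDimLeOne O _ hreg h1 hof hdom
    exact ⟨B, hBfg, hBO, hreg, hO ▸ hRO⟩
  -- dimension 2: the quadratic sequence along `O`
  have h2 : ringKrullDim (locAtCentre B.toSubring O) = 2 := ringKrullDim_eq_two_of_le_two hdim h1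
  have hOtop : O ≠ ⊤ := by
    rintro rfl
    have h0 := ringKrullDim_eq_zero_of_subringDominates_top _ hdom
    rw [h0] at h2
    exact absurd h2 (by decide)
  obtain ⟨Rs, hRs0, hstep⟩ := stub_quadraticSequence O hOtop _ hreg hof hdom
  have hreg0 : IsRegularLocalRing (Rs 0) := by rw [hRs0]; exact hreg
  have h20 : ringKrullDim (Rs 0) = 2 := by rw [hRs0]; exact h2
  have hof0 : IsLocalRingOf (Rs 0) := by rw [hRs0]; exact hof
  have hdom0 : SubringDominates (Rs 0) O.toSubring := by rw [hRs0]; exact hdom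
  have hunion := AbhyankarQuadraticUnion_holds K O Rs hreg0 h20 hof0 hdom0 hstep
  -- the generators of `R` lie in some `Rs N`
  obtain ⟨s, hs⟩ := hR
  have hmono := sequence_monotone hstep
  have hsN : ∃ N, (↑s : Set K) ⊆ Rs N := by
    have hx : ∀ x ∈ s, ∃ i, x ∈ Rs i := fun x hx =>
      (hunion x).mp (hRO (hs ▸ Algebra.subset_adjoin hx))
    choose i hi using hx
    refine ⟨s.attach.sup fun x => i x.1 x.2, fun x hx => ?_⟩
    exact hmono (Finset.le_sup (f := fun x : {x // x ∈ s} => i x.1 x.2)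
      (Finset.mem_attach s ⟨x, hx⟩)) (hi x hx)
  obtain ⟨N, hN⟩ := hsN
  obtain ⟨t, htO, hRN'⟩ := stub_sequenceCollapse O B.toSubring hBO Rs hRs0 hstep N
  have hRN : Rs N = locAtCentre (Subring.closure ((B : Set K) ∪ ↑t)) O := hRN'
  -- the finitely generated model `C = B[t] ⊆ O`
  let C : Subalgebra k K := Algebra.adjoin k ((B : Set K) ∪ ↑t)
  have hC : C.toSubring = Subring.closure ((B : Set K) ∪ ↑t) := by
    change (Algebra.adjoin k ((B : Set K) ∪ ↑t)).toSubring = _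
    rw [Algebra.adjoin_eq_ring_closure]
    apply le_antisymm
    · refine Subring.closure_le.mpr ?_
      rintro z (⟨c, rfl⟩ | hz)
      · exact Subring.subset_closure (Or.inl (B.algebraMap_mem c))
      · exact Subring.subset_closure hz
    · exact Subring.closure_mono Set.subset_union_right
  have hCfg : C.FG := by
    change (Algebra.adjoin k ((B : Set K) ∪ ↑t)).FG
    rw [Algebra.adjoin_union, Algebra.adjoin_eq B]
    exact hBfg.sup (Subalgebra.fg_adjoin_finset t)
  have hCO : C.toSubring ≤ O.toSubring := by
    rw [hC]
    exact Subring.closure_le.mpr (Set.union_subset hBO htO)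
  have hregC : IsRegularLocalRing (locAtCentre C.toSubring O) := by
    rw [hC, ← hRN]
    exact isRegularLocalRing_sequence hreg0 hstep N
  have hRC : R.toSubring ≤ locAtCentre C.toSubring O := by
    rw [hC, ← hRN, ← hs]
    have hk : ∀ c : k, algebraMap k K c ∈ Rs N := fun c =>
      hmono (Nat.zero_le N) (hRs0 ▸ le_locAtCentre _ O (B.algebraMap_mem c))
    change Algebra.adjoin k (↑s : Set K) ≤ (⟨(Rs N).toSubsemiring, hk⟩ : Subalgebra k K)
    exact Algebra.adjoin_le hN
  exact ⟨C, hCfg, hCO, hregC, hRC⟩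

/-- **Relative local uniformization at valuation rings with a regular centre of dimension
`≤ 2` on some affine model** (Zariski 1939 / Abhyankar 1956, Lemma 12, in the wording of
Novacoski–Spivakovsky's Def. 2.20; the local-uniformization form of the fourth proved family
of the crux `ValuativeSmoothing`, no perfectness of `k` needed). For fields `k ⊆ K`, a
valuation ring `O` of `K` and a finitely generated `k`-subalgebra `B ⊆ O` with `Frac B = K`
such that `locAtCentre B O` (the local ring of `B` at the centre of `O`) is a regular local
ring of Krull dimension `≤ 2`, `RelLocalUniformization k K O` holds: every finitely generated
`R ⊆ O` lies in `locAtCentre C O` for a finitely generated `C ⊆ O` regular at the centre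
(`exists_fg_regularCentre_model`: `O = locAtCentre B O` in dimension `≤ 1`, Abhyankar's union
lemma for the quadratic sequence along `O` in dimension `2`), and then in a finitely generated
`A = C[z⁻¹, …] ⊆ O` regular at the centre (`relLU_core_of_locAtCentre`).
[cite: Abhyankar1956Valuations, Lemma 12] -/
theorem relLU_of_regularCentre (k K : Type) [Field k] [Field K] [Algebra k K]
    (O : ValuationSubring K) (B : Subalgebra k K) (hBfg : B.FG) (hBO : B.toSubring ≤ O.toSubring)
    (hfrac : ∀ z : K, ∃ a ∈ B, ∃ b ∈ B, b ≠ 0 ∧ z = a / b)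
    (hreg : IsRegularLocalRing (locAtCentre B.toSubring O))
    (hdim : ringKrullDim (locAtCentre B.toSubring O) ≤ 2) :
    RelLocalUniformization k K O := by
  intro R hR _ hRO
  obtain ⟨C, hCfg, hCO, hregC, hRC⟩ :=
    exists_fg_regularCentre_model k K O B hBfg hBO hfrac hreg hdim R hR hRO
  exact relLU_core_of_locAtCentre k K O C hCfg hCO hregC R hR hRC

/-- **Every valuation ring of a purely transcendental extension of transcendence degree two
admits relative local uniformization** (Zariski 1939 / Abhyankar 1956; any base field `k`, any
characteristic). For `K = k(x, y)` with `(x, y)` algebraically independent over `k` and EVERY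
valuation ring `O ⊇ k` of `K`, `RelLocalUniformization k K O` holds: the polynomial model
`k[x^{±1}, y^{±1}] ⊆ O` is regular of dimension `2` at the centre (`stub_polynomialModel`), so
`relLU_of_regularCentre` applies. This family contains the rank-one DEFECT valuations with
dense value group (`Γ ≅ ℤ[1/p]`, `κ = k`). [cite: Abhyankar1956Valuations, Lemma 12] -/
theorem relLU_of_purelyTranscendental_two (k K : Type) [Field k] [Field K] [Algebra k K]
    (x y : K) (hxy : AlgebraicIndependent k ![x, y])
    (hgen : ∀ z : K, ∃ a ∈ Algebra.adjoin k {x, y}, ∃ b ∈ Algebra.adjoin k {x, y},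
      b ≠ 0 ∧ z = a / b)
    (O : ValuationSubring K) (hO : ∀ c : k, algebraMap k K c ∈ O) :
    RelLocalUniformization k K O := by
  obtain ⟨B, hBfg, hBO, hfrac, hreg, hdim⟩ := stub_polynomialModel k K x y hxy hgen O hO
  exact relLU_of_regularCentre k K O B hBfg hBO hfrac hreg hdim

end Summit.ResolutionOfSingularities.ResolutionOfSingularities.Theorems.ValuativeSmoothing
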